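import Summits.BirchSwinnertonDyer.BirchSwinnertonDyer.Theses.TameQuarticManinParity
import HarnessLib

/-!
# Route `TameQuarticManinParity`: G34 `TprimeIrrCongruentNewformCarriesTorsionRepOfEverywhere` (stmt-BirchSwinnertonDyer-23842)
# BY NAME — «the separating set is free»: CONG33 (stmt-23817) from finiteness of newforms / primes and the everywhere-congruent case

Lead seat `cruxlead-stmt-BirchSwinnertonDyer-23367` (crux MS `TprimeIrrModThreeSaturation`, line `abelian-fixed-points`), landing
the pen's LINE 34 glue (bsd-idea-3 g10, `LINE34_CONG33_of.lean`) verbatim up to namespace/docstrings (helpers privatised).  CONG33 is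
the Galois half of the crux's stub L31 (via G33, landed alongside).  THEOREMS plus four PRIVATE plumbing definitions (the
separating set and its pieces, used only inside this file); no named fact, no `sorry`.  No summit is proved; BSD is NOT proved.
-/

set_option autoImplicit false
-- D-0017: single-problem summit, so `Summit.BirchSwinnertonDyer.BirchSwinnertonDyer.…` repeats a namespace BY DESIGN.
set_option linter.dupNamespace false

noncomputable section

namespace Summit.BirchSwinnertonDyer.BirchSwinnertonDyer.Theorems.TameQuarticManinParity

open Summit.BirchSwinnertonDyer.BirchSwinnertonDyer.Theses.TameQuarticManinParity

open scoped Classical MatrixGroups ModularForm NumberField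
open Polynomial
open Literature.NumberTheory Literature.NumberTheory.GaloisRepresentations
  Literature.NumberTheory.EllipticCurves Literature.NumberTheory.EllipticCurves.ModularForms
  Literature.NumberTheory.DiophantineGeometry

section Glue

variable (W : WeierstrassCurve ℚ)

/-- The primes of intrinsic congruence of the pair `(g, 𝔐)` with `W`: the Hecke polynomial of `g`
at `p` is integral and reduces to `X² − a_p(W) X + p` modulo `𝔐` (private plumbing). [folklore] -/
private def congSet {M : ℕ} [NeZero M] (g : CuspForm (CongruenceSubgroup.Gamma1 M) 2)
    (𝔐 : Ideal (coeffCharIntegers g)) : Set ℕ :=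
  {p | ∃ P : Polynomial (coeffCharIntegers g),
    P.map (algebraMap (coeffCharIntegers g) (coeffCharField g)) = heckePolynomial g p ∧
    P.coeff 1 + ((W.LFunction p : ℤ) : coeffCharIntegers g) ∈ 𝔐 ∧
    P.coeff 0 - ((p : ℕ) : coeffCharIntegers g) ∈ 𝔐}

/-- The least disagreement prime of `(g, 𝔐)` with `W` (as a `0`- or `1`-element set; private plumbing). [folklore] -/
private noncomputable def badPrimes {M : ℕ} [NeZero M] (g : CuspForm (CongruenceSubgroup.Gamma1 M) 2)
    (𝔐 : Ideal (coeffCharIntegers g)) : Finset ℕ :=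
  if h : ∃ p : ℕ, p.Prime ∧ ¬ p ∣ 3 * W.conductorNorm ℤ ∧ p ∉ congSet W g 𝔐 then {Nat.find h}
  else ∅

/-- The disagreement primes at one level `M` (private plumbing). [folklore] -/
private noncomputable def levelSet (hFa : GammaOneNewformsFinite) (hFb : NewformCoeffPrimesOverFinite)
    (M : ℕ) [NeZero M] : Finset ℕ :=
  (hFa M 2).toFinset.attach.biUnion fun x =>
    (hFb M x.1 ((hFa M 2).mem_toFinset.mp x.2) 3 three_ne_zero).toFinset.biUnion
      fun 𝔐 => badPrimes W x.1 𝔐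

/-- The separating set: all least disagreement primes over all levels `M′ ∣ N_W` (private plumbing). [folklore] -/
private noncomputable def sepSet (hFa : GammaOneNewformsFinite) (hFb : NewformCoeffPrimesOverFinite) :
    Finset ℕ :=
  (Nat.divisors (W.conductorNorm ℤ)).attach.biUnion fun d =>
    haveI : NeZero d.1 := ⟨(Nat.pos_of_mem_divisors d.2).ne'⟩
    levelSet W hFa hFb d.1

variable {W}

/-- The Hecke polynomial is monic quadratic: coefficient of `X²` (plumbing). [folklore] -/
private theorem heckePolynomial_coeff_two {M : ℕ} [NeZero M] (g : CuspForm (CongruenceSubgroup.Gamma1 M) 2)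
    (p : ℕ) : (heckePolynomial g p).coeff 2 = 1 := by
  simp [heckePolynomial]

/-- The Hecke polynomial has degree `2`: higher coefficients vanish (plumbing). [folklore] -/
private theorem heckePolynomial_coeff_add_three {M : ℕ} [NeZero M]
    (g : CuspForm (CongruenceSubgroup.Gamma1 M) 2) (p n : ℕ) :
    (heckePolynomial g p).coeff (n + 3) = 0 := by
  simp [heckePolynomial, coeff_X_pow]

/-- `𝓞_g → K_g` is injective (plumbing). [folklore] -/
private theorem algebraMap_coeffCharIntegers_injective {M : ℕ} [NeZero M]
    (g : CuspForm (CongruenceSubgroup.Gamma1 M) 2) :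
    Function.Injective (algebraMap (coeffCharIntegers g) (coeffCharField g)) :=
  Subtype.val_injective

/-- Coefficient bookkeeping: for an integral lift `P` of the Hecke polynomial, `P` reduces under
`ι : 𝓞_g → k` to `X² − a_p(W) X + p` iff `P₁ + a_p(W), P₀ − p ∈ ker ι` (plumbing). [folklore] -/
private theorem map_eq_iff_coeff_mem_ker {M : ℕ} [NeZero M] (g : CuspForm (CongruenceSubgroup.Gamma1 M) 2)
    {k : Type} [Field k] (ι : coeffCharIntegers g →+* k) (p : ℕ)
    (P : Polynomial (coeffCharIntegers g))
    (hP : P.map (algebraMap (coeffCharIntegers g) (coeffCharField g)) = heckePolynomial g p) :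
    P.map ι = X ^ 2 - C ((W.LFunction p : ℤ) : k) * X + C (p : k) ↔
      (P.coeff 1 + ((W.LFunction p : ℤ) : coeffCharIntegers g) ∈ RingHom.ker ι ∧
        P.coeff 0 - ((p : ℕ) : coeffCharIntegers g) ∈ RingHom.ker ι) := by
  have hinj := algebraMap_coeffCharIntegers_injective g
  have h2 : P.coeff 2 = 1 := by
    have := congrArg (fun Q => Q.coeff 2) hP
    simp only [coeff_map, heckePolynomial_coeff_two] at this
    exact hinj (by simpa using this)
  have h3 : ∀ n, P.coeff (n + 3) = 0 := by
    intro n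
    have := congrArg (fun Q => Q.coeff (n + 3)) hP
    simp only [coeff_map, heckePolynomial_coeff_add_three] at this
    exact hinj (by simpa using this)
  constructor
  · intro h
    have h1 := congrArg (fun Q => Q.coeff 1) h
    have h0 := congrArg (fun Q => Q.coeff 0) h
    simp only [coeff_map, coeff_add, coeff_sub, coeff_X_pow, coeff_C_mul, coeff_X, coeff_C] at h1 h0
    norm_num at h1 h0
    refine ⟨?_, ?_⟩
    · rw [RingHom.mem_ker, map_add, map_intCast, h1]; ring
    · rw [RingHom.mem_ker, map_sub, map_natCast, h0]; ring
  · rintro ⟨h1, h0⟩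
    rw [RingHom.mem_ker, map_add, map_intCast] at h1
    rw [RingHom.mem_ker, map_sub, map_natCast] at h0
    ext n
    rcases n with _ | _ | _ | n
    · simp only [coeff_map, coeff_add, coeff_sub, coeff_X_pow, coeff_C_mul, coeff_X, coeff_C]
      norm_num; linear_combination h0
    · simp only [coeff_map, coeff_add, coeff_sub, coeff_X_pow, coeff_C_mul, coeff_X, coeff_C]
      norm_num; linear_combination h1
    · simp only [coeff_map, coeff_add, coeff_sub, coeff_X_pow, coeff_C_mul, coeff_X, coeff_C, h2]
      norm_num
    · simp only [coeff_map, coeff_add, coeff_sub, coeff_X_pow, coeff_C_mul, coeff_X, coeff_C, h3]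
      norm_num
      simp

/-- Members of the separating set are primes not dividing `3N_W` (plumbing). [folklore] -/
private theorem mem_sepSet_prime {hFa : GammaOneNewformsFinite} {hFb : NewformCoeffPrimesOverFinite} {p : ℕ}
    (hp : p ∈ sepSet W hFa hFb) : p.Prime ∧ ¬ p ∣ 3 * W.conductorNorm ℤ := by
  simp only [sepSet, levelSet, Finset.mem_biUnion, Finset.mem_attach, true_and,
    Subtype.exists] at hp
  obtain ⟨d, hd, x, hx, 𝔐, h𝔐, hp⟩ := hp
  unfold badPrimes at hp
  split_ifs at hp with h
  · rw [Finset.mem_singleton] at hp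
    subst hp
    exact ⟨(Nat.find_spec h).1, (Nat.find_spec h).2.1⟩
  · simp at hp

/-- **G34 `TprimeIrrCongruentNewformCarriesTorsionRepOfEverywhere` (stmt-BirchSwinnertonDyer-23842) by name — LINE 34 glue,
kernel-checked**: `GammaOneNewformsFinite (FIN34a, 23839) → NewformCoeffPrimesOverFinite (FIN34b, 23840) →
TorsionRepOfEverywhereCongruentNewform (CONG∞, 23841) → TprimeIrrCongruentNewformCarriesTorsionRep (CONG33, 23817)`.  The
separating set is the union, over the finitely many pairs `(g, 𝔐)` (newforms `g` of level `M′ ∣ N_W`, primes `𝔐 ∋ 3` of `𝓞_g`),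
of the LEAST prime of disagreement with `W` (if any); a packet congruent to `W` on it is congruent everywhere, and the
everywhere-congruent case is CONG∞.  No Chebotarev / Brauer–Nesbitt in this glue. [cite: DeligneSerreASENS1974, §6, Thm. 6.7 (derived reading: the separating set of a finite family of residual packets)] -/
theorem congruentNewformCarriesTorsionRep_of_everywhere :
    TprimeIrrCongruentNewformCarriesTorsionRepOfEverywhere := by
  intro hFa hFb hC W _ hirr
  refine ⟨sepSet W hFa hFb, fun p hp => mem_sepSet_prime hp, ?_⟩
  intro k _ _ _ _ _ j M' _ hM' g ιg hg hcong ρ hρ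
  set 𝔐 : Ideal (coeffCharIntegers g) := RingHom.ker ιg with h𝔐def
  by_cases hall : ∀ p : ℕ, p.Prime → ¬ p ∣ 3 * W.conductorNorm ℤ → p ∈ congSet W g 𝔐
  · refine hC W hirr k j M' hM' g ιg hg ?_ ρ hρ
    intro p hp hpN
    obtain ⟨P, hP, h1, h0⟩ := hall p hp hpN
    exact ⟨P, hP, (map_eq_iff_coeff_mem_ker g ιg p P hP).2 ⟨h1, h0⟩⟩
  · push Not at hall
    obtain ⟨p, hp, hpN, hnot⟩ := hall
    have hex : ∃ p : ℕ, p.Prime ∧ ¬ p ∣ 3 * W.conductorNorm ℤ ∧ p ∉ congSet W g 𝔐 :=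
      ⟨p, hp, hpN, hnot⟩
    have hspec := Nat.find_spec hex
    have hN : W.conductorNorm ℤ ≠ 0 := (W.conductorNorm_pos_holds).ne'
    have h𝔐 : 𝔐 ∈ {𝔐 : Ideal (coeffCharIntegers g) |
        𝔐.IsPrime ∧ ((3 : ℕ) : coeffCharIntegers g) ∈ 𝔐} := by
      refine ⟨RingHom.ker_isPrime ιg, ?_⟩
      rw [h𝔐def, RingHom.mem_ker, map_natCast]
      exact CharP.cast_eq_zero k 3
    have hmem : Nat.find hex ∈ sepSet W hFa hFb := by
      simp only [sepSet, Finset.mem_biUnion, Finset.mem_attach, true_and, Subtype.exists]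
      refine ⟨M', Nat.mem_divisors.mpr ⟨hM', hN⟩, ?_⟩
      simp only [levelSet, Finset.mem_biUnion, Finset.mem_attach, true_and, Subtype.exists]
      refine ⟨g, (hFa M' 2).mem_toFinset.mpr hg, 𝔐, (Set.Finite.mem_toFinset _).mpr h𝔐, ?_⟩
      simp only [badPrimes, dif_pos hex, Finset.mem_singleton]
    obtain ⟨P, hP, hPι⟩ := hcong _ hmem
    exact (hspec.2.2 ⟨P, hP, ((map_eq_iff_coeff_mem_ker g ιg _ P hP).1 hPι).1,
      ((map_eq_iff_coeff_mem_ker g ιg _ P hP).1 hPι).2⟩).elim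

end Glue

end Summit.BirchSwinnertonDyer.BirchSwinnertonDyer.Theorems.TameQuarticManinParity

end
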